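import Summits.ABC.IUTFork.Cor312PinnedRegionsThreePins
import Summits.ABC.IUTFork.Cor312PilotIdelesPrCapstone
import Summits.ABC.IUTFork.Cor312ProvenanceGenuine
import Summits.ABC.IUTFork.Cor312ProvKIdeles
import Summits.ABC.IUTFork.Thm311Real3
import Summits.ABC.IUTFork.LDHGenuinePoint
import Summits.ABC.ABC.Theorems.IUTThetaPilotABCOfCor312
import HarnessLib

/-!
# Branch C, the PER-IMAGE engine AT THE GENUINE REAL SETTING OVER `K` (`abc_of_S_perImage_genuineK`): the (P)-line certificate of record
# (abc-iut-S-d1 `abc_of_S_perImage_genuine`, p432966) RE-BASED at the constructed `K`-level pilot datum `Cor312Prov.pilotDataOfK T.D T.K`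
# — exactly as v5 (p434856) re-based v4 — so that its SIDE class becomes SATISFIABLE (repair R1 of FINDING C-cert-3-F1 for the (P) line)

C scoreboard, per-image S-line at the genuine setting OVER `K` (`abc_of_S_perImage_genuineK`): per datum S 1 · PIN 1 · FACT 0 · CONE 0 · READ 1 ·
SIDE 3 = 6 explicit; NO pilot-data binder, NO provenance binder `hX`, NO Θ-idele condition, NO `(P, l)`-level binder (no `hvol` / `hreg`).
ANTECEDENT (SIDE class `htq0 htq1 htq`): SATISFIABLE at every genuine datum — `perImage_genuineK_sideConditions_satisfiable` (§3, from
abc-iut-C-cert-3 `Cor312Prov.exists_realising_qIdeles_pilotDataOfK`, p434704 = [IUTchI] Ex. 3.2 (iv) as a theorem of the typed `K`).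
Reference: `abc_of_S_perImage_genuine` (p432966): per datum 7 explicit, SIDE class `hX ∧ htq0 ∧ htq` UNSATISFIABLE as typed at every genuine datum
(abc-iut-w6-d110 `abc_of_S_perImage_genuine_sideConditions_false`, p435435, from C-cert-3 F1 p432420).

PROOF-ONLY companion (no `def`, no new `Prop`) of the abc-iut cell, seat abc-iut-w6-d110 (gen 2; block C / W6). TAKES NO SIDE on [IUTchIII]
Cor. 3.12, on the reading (U)/(P) of `−|log(Θ)|`, or on any author. WHAT CHANGES w.r.t. p432966 (and nothing else): the Dupuy–Hilado pilot datum is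
no longer a binder `X : PilotData T.F` tied to `T.D` by `hX : IsPilotDataOf T.D X` (which forces the q-ideles to live in the completions of `T.F`,
where `2l ∤ ord_v(q_v)` by [IUTchI] Def. 3.1 (c)); it IS abc-iut-C-cert-3's `Cor312Prov.pilotDataOfK T.D T.K` (`Cor312ProvK.lean`, p434046: c312-8's
`pilotDataOfF T.D` base-changed along `F ⊆ K = F(E_F[l])`), and the q-ideles live in the completions `K_w`, where print puts them ([IUTchI] Ex. 3.2 (iv):
`q̲_v = q_v^{1/2l} ∈ K_v̲`) and where realising ideles EXIST (p434704). The q-side READ is discharged OVER `K` by base-change invariance of the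
degree-normalised q-number: c312-7 `negLogQ_settingPrVolSharp` (`−|log(q)| = −deĝ_K(P_q)` at realising `tq`, any base field) ∘ C-cert-3
`absLogq_eq_ndeg_qPilot_pilotDataOfK` (`deĝ_K(P_q^K) = |log(q)|` of `D`, [IUTchIV] Thm. 1.10 p. 23) ∘ c312-8 `negAbsLogQ_eq_neg_absLogq_of_isVolumeInputOf`
(p413743). Everything Θ-side is FIELD-GENERIC and reused verbatim from p432966's route: PR-1 `Cor312Vol.reading3_iff_pilotKummerIndRelated`
(S ⟺ READING 3 under the two pins, with Thm. 3.11 (ii)(b)@n := `rfl` in c312-5's strictified reading — CAVEAT as in Shrink1/Shrink2/p432966: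
non-identity Kummer transport not represented, campaign M), the definitional unfolding of `negLogQ` as the procession-normalised log-volume of ONE
global possible image (the q-pilot regions), and the per-image Θ-reading `hΘP`.

PER DATUM (`PerImageK.cor312PerImageOf_of_S_genuineK`, explicit `Prop` binders): [S] `hS` · [PIN] `hPin` (two pins) · [READ] `hΘP` (every global
possible image of the genuine setting over `K` has procession-normalised log-volume `≤ I.negLogThetaPerImage` — OPEN like the C lead's G1 Θ-half;
presupposes no estimate) · [SIDE] `htq0`, `htq1`, `htq` — and `hI : IsVolumeInputOf D I` (at the apex: the datum's own field). §2 folds §1 under each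
datum's bundled instances into abc-iut-S2's `ABC_of_cor312PerImage` (ONLY hypothesis `Cor22.Cor312PerImageAtDatum`; the per-image hull estimate
(ii′-P) `ThetaPartII.stub_hullVolumePerImage` is a THEOREM at every datum), exactly as p432966 §2 does.

MOVEMENT p432966 → here: per datum 7 → 6 (`hX` GONE), SIDE 4 → 3, SIDE class UNSAT-as-typed (p435435) → SATISFIABLE (§3); S + PIN + READ unchanged.
NOT CHANGED: S_H ∧ q-pin is REFUTED at DEEP packets in radii form at any base field (p432372; at `pilotDataOfK`: p436422); shallow data: open.
HONEST FRAMING: locates / conditionally verifies; nothing here asserts that abc is proved or refuted, that [IUTchIII] Cor. 3.12 or Thm. 3.11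
holds or fails, or takes a side on any author; «`ABC` follows from S + the listed hypotheses AS TYPED, at these data»; typed ≠ proved.
[claim: Mochizuki2012, status: disputed] [cite: Mochizuki2012, IUTchI Def. 3.1 (b),(c) p. 61, Ex. 3.2 (iv) p. 71; IUTchIII Cor. 3.12 p. 173–174,
Step (x) p. 181; IUTchIV Thm. 1.10 p. 23] [cite: DupuyHilado2025, §3.3–§3.4]
-/

noncomputable section

open Set Function NumberField IsDedekindDomain

namespace Summit.ABC.IUTFork.Conditional

open Thm311 Thm311.Real Cor312 Cor312Vol Cor312Prov Literature.IUT.LogThetaLattice Literature.IUT.LogVolume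
  Literature.IUT.HodgeTheaters Literature.IUT.LogVolume.ThetaData

/-! ## §1. One datum over `L ⊇ F` at the constructed pilot datum: `I.Cor312PerImageOf` from S + two pins + the per-image Θ-reading + q-idele side conditions -/

section PerDatum

variable {F K Fbar : Type} [Field F] [NumberField F] [Field K] [NumberField K] [Algebra F K] [Field Fbar]
  [Algebra F Fbar] [Algebra K Fbar] {E : WeierstrassCurve F} [E.IsElliptic] {l : ℕ} {Pb : BadPlacePredicates K}
  (D : InitialThetaData F K Fbar E l Pb) {I : ThetaVolumeInput (fieldOfModuli E) K}
  (L : Type) [Field L] [NumberField L] [Algebra F L] (M : Type) [Field M] [NumberField M]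
  (archPk : ∀ (j : (thetaIndex (pilotDataOfK D L)).Label) (vQ : (thetaIndex (pilotDataOfK D L)).VQ), Set ((logShellsDH (pilotDataOfK D L) (analyticLogv L)).Packet j vQ))
  (archSub : ∀ (j : (thetaIndex (pilotDataOfK D L)).Label) (v : (thetaIndex (pilotDataOfK D L)).V),
    Set ((logShellsDH (pilotDataOfK D L) (analyticLogv L)).Packet j ((thetaIndex (pilotDataOfK D L)).over v)))
  (Ψ : ℤ → ∀ v : (thetaIndex (pilotDataOfK D L)).V, v ∈ (thetaIndex (pilotDataOfK D L)).Vbad → Set ((logShellsDH (pilotDataOfK D L) (analyticLogv L)).StarPacket v))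
  (act : ℤ → ∀ v : (thetaIndex (pilotDataOfK D L)).V, v ∈ (thetaIndex (pilotDataOfK D L)).Vbad →
    (logShellsDH (pilotDataOfK D L) (analyticLogv L)).StarPacket v → Module.End ℚ ((logShellsDH (pilotDataOfK D L) (analyticLogv L)).StarPacket v))
  (Mmod : ℤ → ∀ j : (thetaIndex (pilotDataOfK D L)).LabelStar, Set ((logShellsDH (pilotDataOfK D L) (analyticLogv L)).GlobalPacket j.1))
  (region : ℤ → ∀ j : (thetaIndex (pilotDataOfK D L)).LabelStar, FinDivisor M → ∀ vQ : (thetaIndex (pilotDataOfK D L)).VQ,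
    Set ((logShellsDH (pilotDataOfK D L) (analyticLogv L)).Packet j.1 vQ))
  (frobAdm : ℤ → ℤ → ∀ (j : (thetaIndex (pilotDataOfK D L)).Label) (vQ : (thetaIndex (pilotDataOfK D L)).VQ),
    Set ((logShellsDH (pilotDataOfK D L) (analyticLogv L)).Packet j vQ) → Prop)
  (frobLogvol : ℤ → ℤ → ∀ (j : (thetaIndex (pilotDataOfK D L)).Label) (vQ : (thetaIndex (pilotDataOfK D L)).VQ),
    Set ((logShellsDH (pilotDataOfK D L) (analyticLogv L)).Packet j vQ) → ℝ)
  (frobMmod : ℤ → ℤ → ∀ j : (thetaIndex (pilotDataOfK D L)).LabelStar, Set ((logShellsDH (pilotDataOfK D L) (analyticLogv L)).GlobalPacket j.1))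
  (unitImage : ℤ → ℤ → ℕ → ∀ (j : (thetaIndex (pilotDataOfK D L)).Label) (vQ : (thetaIndex (pilotDataOfK D L)).VQ),
    Set ((logShellsDH (pilotDataOfK D L) (analyticLogv L)).Packet j vQ))
  (ballImage : ℤ → ℤ → ∀ (j : (thetaIndex (pilotDataOfK D L)).Label) (vQ : (thetaIndex (pilotDataOfK D L)).VQ),
    Set ((logShellsDH (pilotDataOfK D L) (analyticLogv L)).Packet j vQ))
  (thetaDiv : ℤ → ℤ → LgpDivisor M (thetaIndex (pilotDataOfK D L)).lstar)
  (n : ℤ) {HT : Type} {LogLink : HT → HT → Type} {IsFull : ∀ {s t : HT}, LogLink s t → Prop}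
  (lat : LGPGaussianLogThetaLattice LogLink IsFull)
  {Frd : Type} {IsoF : Frd → Frd → Type} {Ob : Frd → Type} {realify : Frd → Frd} {Strip : Type}
  {IsoS : Strip → Strip → Type} {Mv : ∀ v : (thetaIndex (pilotDataOfK D L)).V, v ∈ (thetaIndex (pilotDataOfK D L)).Vbad → Type}
  [∀ v h, Monoid (Mv v h)]
  (sig : GlobalLGPFrobenioidSignature (thetaIndex (pilotDataOfK D L)).lstar (thetaIndex (pilotDataOfK D L)).V (· ∈ (thetaIndex (pilotDataOfK D L)).Vbad)
    Frd IsoF Ob realify Strip IsoS Mv)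
  (split : SplittingMonoids Mv) {ObΔ : Type} {N : ∀ v : (thetaIndex (pilotDataOfK D L)).V, v ∈ (thetaIndex (pilotDataOfK D L)).Vbad → Type}
  [∀ v h, Monoid (N v h)] (qData : QPilotData ObΔ N)
  (t : ∀ (pp : Nat.Primes) (_ : Fin (pilotDataOfK D L).lstar) (x : (thetaIndex (pilotDataOfK D L)).Fibre (.inr pp)),
    haveI : Fact (pp : ℕ).Prime := ⟨pp.2⟩; kOf (pilotDataOfK D L) pp.1 x)
  (tq : ∀ (pp : Nat.Primes) (x : (thetaIndex (pilotDataOfK D L)).Fibre (.inr pp)), haveI : Fact (pp : ℕ).Prime := ⟨pp.2⟩; kOf (pilotDataOfK D L) pp.1 x)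
  (ρ : (∀ v : (thetaIndex (pilotDataOfK D L)).V, v ∈ (thetaIndex (pilotDataOfK D L)).Vbad → Set ((logShellsDH (pilotDataOfK D L) (analyticLogv L)).StarPacket v)) →
    ∀ (j : (thetaIndex (pilotDataOfK D L)).Label) (vQ : (thetaIndex (pilotDataOfK D L)).VQ), Set ((logShellsDH (pilotDataOfK D L) (analyticLogv L)).Packet j vQ))
  (qK : ∀ v : (thetaIndex (pilotDataOfK D L)).V, v ∈ (thetaIndex (pilotDataOfK D L)).Vbad → Set ((logShellsDH (pilotDataOfK D L) (analyticLogv L)).StarPacket v))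


/-- **One datum, genuine real setting OVER `L ⊇ F` at `pilotDataOfK D L`, PER-IMAGE line: `I.Cor312PerImageOf` (`−|log(q)| ≤ −|log(Θ)|_(P)` for the
DEFINED numbers of a genuine Θ-volume input `I` OF `D`) FROM: S (`PilotKummerIndRelated`), the two region pins, the per-image Θ-side reading `hΘP`,
and the q-idele side conditions `htq0`, `htq1`, `htq` in the completions of `L` — NO pilot-data / provenance binder, NO Θ-idele condition, NO
volume estimate.** Route, by name (p432966's, with the q-side over `L`): Thm. 3.11 (ii)(b)@n := `rfl` + PR-1 `reading3_iff_pilotKummerIndRelated`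
⟹ READING 3; the definitional unfolding of `negLogQ` with `hΘP`; q-side: c312-7 `negLogQ_settingPrVolSharp` + C-cert-3
`absLogq_eq_ndeg_qPilot_pilotDataOfK` + c312-8 `negAbsLogQ_eq_neg_absLogq_of_isVolumeInputOf`. «`I.Cor312PerImageOf` follows from S + these
hypotheses as typed, at these data» — no side taken. [cite: Mochizuki2012, IUTchI Ex. 3.2 (iv) p. 71; IUTchIV Thm. 1.10 p. 23] [claim: Mochizuki2012, status: disputed] -/
theorem PerImageK.cor312PerImageOf_of_S_genuineK (hI : ThetaData.IsVolumeInputOf D I)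
    (htq0 : ∀ pp x, tq pp x ≠ 0)
    (htq1 : ∀ (pp : Nat.Primes) (x : (thetaIndex (pilotDataOfK D L)).Fibre (.inr pp)),
      haveI : Fact (pp : ℕ).Prime := ⟨pp.2⟩; placeOf (pilotDataOfK D L) pp.1 x ∉ (pilotDataOfK D L).S → ‖tq pp x‖ = 1)
    (htq : ∀ (pp : Nat.Primes) (x : (thetaIndex (pilotDataOfK D L)).Fibre (.inr pp)),
      haveI : Fact (pp : ℕ).Prime := ⟨pp.2⟩
      Real.log ‖tq pp x‖ = -((pilotDataOfK D L).qPilot (placeOf (pilotDataOfK D L) pp.1 x)) * logNorm L (placeOf (pilotDataOfK D L) pp.1 x) /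
        localDegree L (placeOf (pilotDataOfK D L) pp.1 x))
    (hS : Cor312Vol.PilotKummerIndRelated
      (LatticeSituation.ofShells (logShellsDH (pilotDataOfK D L) (analyticLogv L)) M archPk archSub
        (summandPiecesPr (pilotDataOfK D L) (logvAnalytic_analyticLogv (F := L))).Adm
        (summandPiecesPr (pilotDataOfK D L) (logvAnalytic_analyticLogv (F := L))).logvol Ψ act Mmod region frobAdm frobLogvol
        (fun k _ => Ψ k) frobMmod unitImage ballImage thetaDiv)
      (settingPrVolSharp (pilotDataOfK D L) (logvAnalytic_analyticLogv (F := L)) M archPk archSub Ψ act Mmod region n lat sig split qData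
        tq t htq0 htq1) ρ qK)
    (hPin : Cor312Vol.PinnedRegions
      (LatticeSituation.ofShells (logShellsDH (pilotDataOfK D L) (analyticLogv L)) M archPk archSub
        (summandPiecesPr (pilotDataOfK D L) (logvAnalytic_analyticLogv (F := L))).Adm
        (summandPiecesPr (pilotDataOfK D L) (logvAnalytic_analyticLogv (F := L))).logvol Ψ act Mmod region frobAdm frobLogvol
        (fun k _ => Ψ k) frobMmod unitImage ballImage thetaDiv)
      (settingPrVolSharp (pilotDataOfK D L) (logvAnalytic_analyticLogv (F := L)) M archPk archSub Ψ act Mmod region n lat sig split qData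
        tq t htq0 htq1) ρ qK)
    (hΘP : ∀ U : ImageChoice
        (settingPrVolSharp (pilotDataOfK D L) (logvAnalytic_analyticLogv (F := L)) M archPk archSub Ψ act Mmod region n lat sig split qData
          tq t htq0 htq1),
      processionNormalized (fun i : Fin (thetaIndex (pilotDataOfK D L)).lstar =>
        ∑ᶠ vQ : (thetaIndex (pilotDataOfK D L)).VQ,
          ((LatticeSituation.ofShells (logShellsDH (pilotDataOfK D L) (analyticLogv L)) M archPk archSub
              (summandPiecesPr (pilotDataOfK D L) (logvAnalytic_analyticLogv (F := L))).Adm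
              (summandPiecesPr (pilotDataOfK D L) (logvAnalytic_analyticLogv (F := L))).logvol Ψ act Mmod region frobAdm frobLogvol
              (fun k _ => Ψ k) frobMmod unitImage ballImage thetaDiv).D
            (settingPrVolSharp (pilotDataOfK D L) (logvAnalytic_analyticLogv (F := L)) M archPk archSub Ψ act Mmod region n lat sig split
              qData tq t htq0 htq1).n).logvol (Setting.labelSucc i) vQ (U.1 (i, vQ))) ≤ I.negLogThetaPerImage) :
    I.Cor312PerImageOf := by
  -- Step 1: READING 3 at the genuine setting — hKumB := rfl, R3 ⟸ S under the two pins
  have h3 := (Cor312Vol.reading3_iff_pilotKummerIndRelated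
    (LatticeSituation.ofShells (logShellsDH (pilotDataOfK D L) (analyticLogv L)) M archPk archSub
      (summandPiecesPr (pilotDataOfK D L) (logvAnalytic_analyticLogv (F := L))).Adm
      (summandPiecesPr (pilotDataOfK D L) (logvAnalytic_analyticLogv (F := L))).logvol Ψ act Mmod region frobAdm frobLogvol
      (fun k _ => Ψ k) frobMmod unitImage ballImage thetaDiv)
    (settingPrVolSharp (pilotDataOfK D L) (logvAnalytic_analyticLogv (F := L)) M archPk archSub Ψ act Mmod region n lat sig split qData
      tq t htq0 htq1) ρ qK (fun _ _ _ => rfl) hPin).2 hS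
  -- Step 2: the q-pilot regions ARE one global possible image, and `negLogQ` is DEFINITIONALLY the procession-normalised
  -- sum of their log-volumes (`Conditional/AbcOfSPerImage.lean` §1, inlined to keep this file import-light)
  have hle : (settingPrVolSharp (pilotDataOfK D L) (logvAnalytic_analyticLogv (F := L)) M archPk archSub Ψ act Mmod region n lat sig split
      qData tq t htq0 htq1).negLogQ ≤ I.negLogThetaPerImage := by
    unfold Setting.negLogQ Setting.qLocal
    exact hΘP ⟨fun s => _, fun s => h3 (Setting.labelSucc s.1) s.2⟩
  -- Step 3: the q-side OVER `L` by base-change invariance — `−|log(q)|` of the setting `= −deĝ_L(P_q)` (c312-7, realising `tq`)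
  -- `= −|log(q)|` of `D` (C-cert-3 `absLogq_eq_ndeg_qPilot_pilotDataOfK`) `= I.negAbsLogQ` (c312-8 provenance of the input)
  rw [negLogQ_settingPrVolSharp (pilotDataOfK D L) (logvAnalytic_analyticLogv (F := L)) M archPk archSub Ψ act Mmod region n lat
    sig split qData t tq htq0 htq1 htq, ← absLogq_eq_ndeg_qPilot_pilotDataOfK D L] at hle
  show I.negAbsLogQ ≤ I.negLogThetaPerImage
  rw [Cor312Prov.negAbsLogQ_eq_neg_absLogq_of_isVolumeInputOf D hI]
  exact hle


end PerDatum

/-! ## §2. The apex: `ABC` on the per-image S-line with the per-datum group AT THE GENUINE REAL SETTING OVER `K` — no `hX`, no `hvol`, no `hΘ`, no Θ-idele condition -/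

section Family

open Literature.NumberTheory.DiophantineGeometry.GenEll Summit.ABC.ABC.Theorems

/-- **`abc_of_S_perImage_genuineK` (branch C, per-image S-line AT THE GENUINE REAL SETTING OVER `K` OF EACH DATUM; per datum explicit
S 1 · PIN 1 · FACT 0 · CONE 0 · READ 1 · SIDE 3 = 6; NO pilot-data / provenance binder; NO `(P, l)`-level binder).** `ABC` from, per `λ`-line point
`P`, prime `l` and genuine Θ-volume datum `T : Cor22.ThetaVolumeDatumAt P l`: DATA = the context binders of c312-7's print-normalised real setting over
`Cor312Prov.pilotDataOfK T.D T.K`, Θ-ideles (free) and q-ideles in the completions of `T.K`, PR-1's `ρ`, `qK`; HYPOTHESES = [SIDE] `htq0`, `htq1`,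
`htq` (q-ideles non-zero, units off `S`, REALISING `P_q` — SATISFIABLE at every datum, §3) · [S] `hS` · [PIN] `hPin` (two pins) · [READ] `hΘP`.
Compared with `abc_of_S_perImage_genuine` (p432966): NO `hX` (7 → 6) and the SIDE class is satisfiable instead of contradictory (p435435). Proof: §1 at
`T.D`, `T.K`, `T.isVolumeInputOf` gives `Cor22.Cor312PerImageAtDatum P l`; then abc-iut-S2's `ABC_of_cor312PerImage`. «`ABC` follows from S + these
hypotheses as typed, at these data» — no side taken on [IUTchIII] Cor. 3.12 or on (U)/(P); typed ≠ proved; instantiated ≠ endorsed.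
[claim: Mochizuki2012, status: disputed] -/
theorem abc_of_S_perImage_genuineK
    -- DATA, per datum: the context binders of the genuine real setting over the CONSTRUCTED `K`-level pilot datum `pilotDataOfK T.D T.K`
    -- (logs FIXED: analytic), Θ-ideles `t` (free), q-ideles `tq` in the completions of `T.K`, PR-1's `ρ`, `qK` — NO pilot-data binder
    (M : ∀ (P : NFPoint) (l : ℕ) (T : Cor22.ThetaVolumeDatumAt P l), Type) [∀ P l T, Field (M P l T)] [∀ P l T, NumberField (M P l T)]
    (archPk : ∀ (P : NFPoint) (l : ℕ) (T : Cor22.ThetaVolumeDatumAt P l), letI := T.instFieldF; letI := T.instNumberFieldF; letI := T.instAlgebraF; letI := T.instFieldK;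
        letI := T.instNumberFieldK; letI := T.instAlgebraK; letI := T.instFieldFbar; letI := T.instAlgebraFbar;
        letI := T.instAlgebraKFbar; letI := T.instIsElliptic;
      ∀ (j : (thetaIndex (pilotDataOfK T.D T.K)).Label) (vQ : (thetaIndex (pilotDataOfK T.D T.K)).VQ), Set ((logShellsDH (pilotDataOfK T.D T.K) (analyticLogv T.K)).Packet j vQ))
    (archSub : ∀ (P : NFPoint) (l : ℕ) (T : Cor22.ThetaVolumeDatumAt P l), letI := T.instFieldF; letI := T.instNumberFieldF; letI := T.instAlgebraF; letI := T.instFieldK;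
        letI := T.instNumberFieldK; letI := T.instAlgebraK; letI := T.instFieldFbar; letI := T.instAlgebraFbar;
        letI := T.instAlgebraKFbar; letI := T.instIsElliptic;
      ∀ (j : (thetaIndex (pilotDataOfK T.D T.K)).Label) (v : (thetaIndex (pilotDataOfK T.D T.K)).V), Set ((logShellsDH (pilotDataOfK T.D T.K) (analyticLogv T.K)).Packet j ((thetaIndex (pilotDataOfK T.D T.K)).over v)))
    (Ψ : ∀ (P : NFPoint) (l : ℕ) (T : Cor22.ThetaVolumeDatumAt P l), letI := T.instFieldF; letI := T.instNumberFieldF; letI := T.instAlgebraF; letI := T.instFieldK;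
        letI := T.instNumberFieldK; letI := T.instAlgebraK; letI := T.instFieldFbar; letI := T.instAlgebraFbar;
        letI := T.instAlgebraKFbar; letI := T.instIsElliptic;
      ℤ → ∀ v : (thetaIndex (pilotDataOfK T.D T.K)).V, v ∈ (thetaIndex (pilotDataOfK T.D T.K)).Vbad → Set ((logShellsDH (pilotDataOfK T.D T.K) (analyticLogv T.K)).StarPacket v))
    (act : ∀ (P : NFPoint) (l : ℕ) (T : Cor22.ThetaVolumeDatumAt P l), letI := T.instFieldF; letI := T.instNumberFieldF; letI := T.instAlgebraF; letI := T.instFieldK;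
        letI := T.instNumberFieldK; letI := T.instAlgebraK; letI := T.instFieldFbar; letI := T.instAlgebraFbar;
        letI := T.instAlgebraKFbar; letI := T.instIsElliptic;
      ℤ → ∀ v : (thetaIndex (pilotDataOfK T.D T.K)).V, v ∈ (thetaIndex (pilotDataOfK T.D T.K)).Vbad → (logShellsDH (pilotDataOfK T.D T.K) (analyticLogv T.K)).StarPacket v → Module.End ℚ ((logShellsDH (pilotDataOfK T.D T.K) (analyticLogv T.K)).StarPacket v))
    (Mmod : ∀ (P : NFPoint) (l : ℕ) (T : Cor22.ThetaVolumeDatumAt P l), letI := T.instFieldF; letI := T.instNumberFieldF; letI := T.instAlgebraF; letI := T.instFieldK;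
        letI := T.instNumberFieldK; letI := T.instAlgebraK; letI := T.instFieldFbar; letI := T.instAlgebraFbar;
        letI := T.instAlgebraKFbar; letI := T.instIsElliptic;
      ℤ → ∀ j : (thetaIndex (pilotDataOfK T.D T.K)).LabelStar, Set ((logShellsDH (pilotDataOfK T.D T.K) (analyticLogv T.K)).GlobalPacket j.1))
    (region : ∀ (P : NFPoint) (l : ℕ) (T : Cor22.ThetaVolumeDatumAt P l), letI := T.instFieldF; letI := T.instNumberFieldF; letI := T.instAlgebraF; letI := T.instFieldK;
        letI := T.instNumberFieldK; letI := T.instAlgebraK; letI := T.instFieldFbar; letI := T.instAlgebraFbar;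
        letI := T.instAlgebraKFbar; letI := T.instIsElliptic;
      ℤ → ∀ j : (thetaIndex (pilotDataOfK T.D T.K)).LabelStar, FinDivisor (M P l T) → ∀ vQ : (thetaIndex (pilotDataOfK T.D T.K)).VQ, Set ((logShellsDH (pilotDataOfK T.D T.K) (analyticLogv T.K)).Packet j.1 vQ))
    (frobAdm : ∀ (P : NFPoint) (l : ℕ) (T : Cor22.ThetaVolumeDatumAt P l), letI := T.instFieldF; letI := T.instNumberFieldF; letI := T.instAlgebraF; letI := T.instFieldK;
        letI := T.instNumberFieldK; letI := T.instAlgebraK; letI := T.instFieldFbar; letI := T.instAlgebraFbar;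
        letI := T.instAlgebraKFbar; letI := T.instIsElliptic;
      ℤ → ℤ → ∀ (j : (thetaIndex (pilotDataOfK T.D T.K)).Label) (vQ : (thetaIndex (pilotDataOfK T.D T.K)).VQ), Set ((logShellsDH (pilotDataOfK T.D T.K) (analyticLogv T.K)).Packet j vQ) → Prop)
    (frobLogvol : ∀ (P : NFPoint) (l : ℕ) (T : Cor22.ThetaVolumeDatumAt P l), letI := T.instFieldF; letI := T.instNumberFieldF; letI := T.instAlgebraF; letI := T.instFieldK;
        letI := T.instNumberFieldK; letI := T.instAlgebraK; letI := T.instFieldFbar; letI := T.instAlgebraFbar;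
        letI := T.instAlgebraKFbar; letI := T.instIsElliptic;
      ℤ → ℤ → ∀ (j : (thetaIndex (pilotDataOfK T.D T.K)).Label) (vQ : (thetaIndex (pilotDataOfK T.D T.K)).VQ), Set ((logShellsDH (pilotDataOfK T.D T.K) (analyticLogv T.K)).Packet j vQ) → ℝ)
    (frobMmod : ∀ (P : NFPoint) (l : ℕ) (T : Cor22.ThetaVolumeDatumAt P l), letI := T.instFieldF; letI := T.instNumberFieldF; letI := T.instAlgebraF; letI := T.instFieldK;
        letI := T.instNumberFieldK; letI := T.instAlgebraK; letI := T.instFieldFbar; letI := T.instAlgebraFbar;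
        letI := T.instAlgebraKFbar; letI := T.instIsElliptic;
      ℤ → ℤ → ∀ j : (thetaIndex (pilotDataOfK T.D T.K)).LabelStar, Set ((logShellsDH (pilotDataOfK T.D T.K) (analyticLogv T.K)).GlobalPacket j.1))
    (unitImage : ∀ (P : NFPoint) (l : ℕ) (T : Cor22.ThetaVolumeDatumAt P l), letI := T.instFieldF; letI := T.instNumberFieldF; letI := T.instAlgebraF; letI := T.instFieldK;
        letI := T.instNumberFieldK; letI := T.instAlgebraK; letI := T.instFieldFbar; letI := T.instAlgebraFbar;
        letI := T.instAlgebraKFbar; letI := T.instIsElliptic;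
      ℤ → ℤ → ℕ → ∀ (j : (thetaIndex (pilotDataOfK T.D T.K)).Label) (vQ : (thetaIndex (pilotDataOfK T.D T.K)).VQ), Set ((logShellsDH (pilotDataOfK T.D T.K) (analyticLogv T.K)).Packet j vQ))
    (ballImage : ∀ (P : NFPoint) (l : ℕ) (T : Cor22.ThetaVolumeDatumAt P l), letI := T.instFieldF; letI := T.instNumberFieldF; letI := T.instAlgebraF; letI := T.instFieldK;
        letI := T.instNumberFieldK; letI := T.instAlgebraK; letI := T.instFieldFbar; letI := T.instAlgebraFbar;
        letI := T.instAlgebraKFbar; letI := T.instIsElliptic;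
      ℤ → ℤ → ∀ (j : (thetaIndex (pilotDataOfK T.D T.K)).Label) (vQ : (thetaIndex (pilotDataOfK T.D T.K)).VQ), Set ((logShellsDH (pilotDataOfK T.D T.K) (analyticLogv T.K)).Packet j vQ))
    (thetaDiv : ∀ (P : NFPoint) (l : ℕ) (T : Cor22.ThetaVolumeDatumAt P l), letI := T.instFieldF; letI := T.instNumberFieldF; letI := T.instAlgebraF; letI := T.instFieldK;
        letI := T.instNumberFieldK; letI := T.instAlgebraK; letI := T.instFieldFbar; letI := T.instAlgebraFbar;
        letI := T.instAlgebraKFbar; letI := T.instIsElliptic;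
      ℤ → ℤ → LgpDivisor (M P l T) (thetaIndex (pilotDataOfK T.D T.K)).lstar)
    (n : ∀ (P : NFPoint) (l : ℕ) (T : Cor22.ThetaVolumeDatumAt P l), ℤ)
    {HT : ∀ (P : NFPoint) (l : ℕ) (T : Cor22.ThetaVolumeDatumAt P l), Type} {LogLink : ∀ (P : NFPoint) (l : ℕ) (T : Cor22.ThetaVolumeDatumAt P l), HT P l T → HT P l T → Type}
    {IsFull : ∀ (P : NFPoint) (l : ℕ) (T : Cor22.ThetaVolumeDatumAt P l), ∀ {s t : HT P l T}, LogLink P l T s t → Prop}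
    (lat : ∀ (P : NFPoint) (l : ℕ) (T : Cor22.ThetaVolumeDatumAt P l), LGPGaussianLogThetaLattice (LogLink P l T) (IsFull P l T))
    {Frd : ∀ (P : NFPoint) (l : ℕ) (T : Cor22.ThetaVolumeDatumAt P l), Type} {IsoF : ∀ (P : NFPoint) (l : ℕ) (T : Cor22.ThetaVolumeDatumAt P l), Frd P l T → Frd P l T → Type} {Ob : ∀ (P : NFPoint) (l : ℕ) (T : Cor22.ThetaVolumeDatumAt P l), Frd P l T → Type}
    {realify : ∀ (P : NFPoint) (l : ℕ) (T : Cor22.ThetaVolumeDatumAt P l), Frd P l T → Frd P l T} {Strip : ∀ (P : NFPoint) (l : ℕ) (T : Cor22.ThetaVolumeDatumAt P l), Type} {IsoS : ∀ (P : NFPoint) (l : ℕ) (T : Cor22.ThetaVolumeDatumAt P l), Strip P l T → Strip P l T → Type}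
    {Mv : ∀ (P : NFPoint) (l : ℕ) (T : Cor22.ThetaVolumeDatumAt P l), letI := T.instFieldF; letI := T.instNumberFieldF; letI := T.instAlgebraF; letI := T.instFieldK;
        letI := T.instNumberFieldK; letI := T.instAlgebraK; letI := T.instFieldFbar; letI := T.instAlgebraFbar;
        letI := T.instAlgebraKFbar; letI := T.instIsElliptic;
      ∀ v : (thetaIndex (pilotDataOfK T.D T.K)).V, v ∈ (thetaIndex (pilotDataOfK T.D T.K)).Vbad → Type}
    [∀ P l T v h, Monoid (Mv P l T v h)]
    (sig : ∀ (P : NFPoint) (l : ℕ) (T : Cor22.ThetaVolumeDatumAt P l), letI := T.instFieldF; letI := T.instNumberFieldF; letI := T.instAlgebraF; letI := T.instFieldK;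
        letI := T.instNumberFieldK; letI := T.instAlgebraK; letI := T.instFieldFbar; letI := T.instAlgebraFbar;
        letI := T.instAlgebraKFbar; letI := T.instIsElliptic;
      GlobalLGPFrobenioidSignature (thetaIndex (pilotDataOfK T.D T.K)).lstar (thetaIndex (pilotDataOfK T.D T.K)).V (· ∈ (thetaIndex (pilotDataOfK T.D T.K)).Vbad) (Frd P l T) (IsoF P l T) (Ob P l T) (realify P l T)
        (Strip P l T) (IsoS P l T) (Mv P l T))
    (split : ∀ (P : NFPoint) (l : ℕ) (T : Cor22.ThetaVolumeDatumAt P l), SplittingMonoids (Mv P l T))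
    {ObΔ : ∀ (P : NFPoint) (l : ℕ) (T : Cor22.ThetaVolumeDatumAt P l), Type} {N : ∀ (P : NFPoint) (l : ℕ) (T : Cor22.ThetaVolumeDatumAt P l), letI := T.instFieldF; letI := T.instNumberFieldF; letI := T.instAlgebraF; letI := T.instFieldK;
        letI := T.instNumberFieldK; letI := T.instAlgebraK; letI := T.instFieldFbar; letI := T.instAlgebraFbar;
        letI := T.instAlgebraKFbar; letI := T.instIsElliptic;
      ∀ v : (thetaIndex (pilotDataOfK T.D T.K)).V, v ∈ (thetaIndex (pilotDataOfK T.D T.K)).Vbad → Type}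
    [∀ P l T v h, Monoid (N P l T v h)] (qData : ∀ (P : NFPoint) (l : ℕ) (T : Cor22.ThetaVolumeDatumAt P l), QPilotData (ObΔ P l T) (N P l T))
    (t : ∀ (P : NFPoint) (l : ℕ) (T : Cor22.ThetaVolumeDatumAt P l), letI := T.instFieldF; letI := T.instNumberFieldF; letI := T.instAlgebraF; letI := T.instFieldK;
        letI := T.instNumberFieldK; letI := T.instAlgebraK; letI := T.instFieldFbar; letI := T.instAlgebraFbar;
        letI := T.instAlgebraKFbar; letI := T.instIsElliptic;
      ∀ (pp : Nat.Primes) (_ : Fin (pilotDataOfK T.D T.K).lstar) (x : (thetaIndex (pilotDataOfK T.D T.K)).Fibre (.inr pp)), haveI : Fact (pp : ℕ).Prime := ⟨pp.2⟩; kOf (pilotDataOfK T.D T.K) pp.1 x)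
    (tq : ∀ (P : NFPoint) (l : ℕ) (T : Cor22.ThetaVolumeDatumAt P l), letI := T.instFieldF; letI := T.instNumberFieldF; letI := T.instAlgebraF; letI := T.instFieldK;
        letI := T.instNumberFieldK; letI := T.instAlgebraK; letI := T.instFieldFbar; letI := T.instAlgebraFbar;
        letI := T.instAlgebraKFbar; letI := T.instIsElliptic;
      ∀ (pp : Nat.Primes) (x : (thetaIndex (pilotDataOfK T.D T.K)).Fibre (.inr pp)), haveI : Fact (pp : ℕ).Prime := ⟨pp.2⟩; kOf (pilotDataOfK T.D T.K) pp.1 x)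
    (ρ : ∀ (P : NFPoint) (l : ℕ) (T : Cor22.ThetaVolumeDatumAt P l), letI := T.instFieldF; letI := T.instNumberFieldF; letI := T.instAlgebraF; letI := T.instFieldK;
        letI := T.instNumberFieldK; letI := T.instAlgebraK; letI := T.instFieldFbar; letI := T.instAlgebraFbar;
        letI := T.instAlgebraKFbar; letI := T.instIsElliptic;
      (∀ v : (thetaIndex (pilotDataOfK T.D T.K)).V, v ∈ (thetaIndex (pilotDataOfK T.D T.K)).Vbad → Set ((logShellsDH (pilotDataOfK T.D T.K) (analyticLogv T.K)).StarPacket v)) → ∀ (j : (thetaIndex (pilotDataOfK T.D T.K)).Label) (vQ : (thetaIndex (pilotDataOfK T.D T.K)).VQ), Set ((logShellsDH (pilotDataOfK T.D T.K) (analyticLogv T.K)).Packet j vQ))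
    (qK : ∀ (P : NFPoint) (l : ℕ) (T : Cor22.ThetaVolumeDatumAt P l), letI := T.instFieldF; letI := T.instNumberFieldF; letI := T.instAlgebraF; letI := T.instFieldK;
        letI := T.instNumberFieldK; letI := T.instAlgebraK; letI := T.instFieldFbar; letI := T.instAlgebraFbar;
        letI := T.instAlgebraKFbar; letI := T.instIsElliptic;
      ∀ v : (thetaIndex (pilotDataOfK T.D T.K)).V, v ∈ (thetaIndex (pilotDataOfK T.D T.K)).Vbad → Set ((logShellsDH (pilotDataOfK T.D T.K) (analyticLogv T.K)).StarPacket v))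
    -- [SIDE] the q-ideles in the completions of `T.K` are non-zero, units off `S`, and REALISE `P_q` (SATISFIABLE: p434704; no Θ-idele condition, no `hX`)
    (htq0 : ∀ P l T pp x, tq P l T pp x ≠ 0)
    (htq1 : ∀ (P : NFPoint) (l : ℕ) (T : Cor22.ThetaVolumeDatumAt P l), letI := T.instFieldF; letI := T.instNumberFieldF; letI := T.instAlgebraF; letI := T.instFieldK;
        letI := T.instNumberFieldK; letI := T.instAlgebraK; letI := T.instFieldFbar; letI := T.instAlgebraFbar;
        letI := T.instAlgebraKFbar; letI := T.instIsElliptic;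
      ∀ (pp : Nat.Primes) (x : (thetaIndex (pilotDataOfK T.D T.K)).Fibre (.inr pp)),
        haveI : Fact (pp : ℕ).Prime := ⟨pp.2⟩; placeOf (pilotDataOfK T.D T.K) pp.1 x ∉ (pilotDataOfK T.D T.K).S → ‖tq P l T pp x‖ = 1)
    (htq : ∀ (P : NFPoint) (l : ℕ) (T : Cor22.ThetaVolumeDatumAt P l), letI := T.instFieldF; letI := T.instNumberFieldF; letI := T.instAlgebraF; letI := T.instFieldK;
        letI := T.instNumberFieldK; letI := T.instAlgebraK; letI := T.instFieldFbar; letI := T.instAlgebraFbar;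
        letI := T.instAlgebraKFbar; letI := T.instIsElliptic;
      ∀ (pp : Nat.Primes) (x : (thetaIndex (pilotDataOfK T.D T.K)).Fibre (.inr pp)),
        haveI : Fact (pp : ℕ).Prime := ⟨pp.2⟩
        Real.log ‖tq P l T pp x‖ = -((pilotDataOfK T.D T.K).qPilot (placeOf (pilotDataOfK T.D T.K) pp.1 x)) * logNorm T.K (placeOf (pilotDataOfK T.D T.K) pp.1 x) /
          localDegree T.K (placeOf (pilotDataOfK T.D T.K) pp.1 x))
    -- [S] the single named proposition, at every datum, AT THESE DATA
    (hS : ∀ (P : NFPoint) (l : ℕ) (T : Cor22.ThetaVolumeDatumAt P l), letI := T.instFieldF; letI := T.instNumberFieldF; letI := T.instAlgebraF; letI := T.instFieldK;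
        letI := T.instNumberFieldK; letI := T.instAlgebraK; letI := T.instFieldFbar; letI := T.instAlgebraFbar;
        letI := T.instAlgebraKFbar; letI := T.instIsElliptic;
      Cor312Vol.PilotKummerIndRelated
        (LatticeSituation.ofShells (logShellsDH (pilotDataOfK T.D T.K) (analyticLogv T.K)) (M P l T) (archPk P l T)
          (archSub P l T) (summandPiecesPr (pilotDataOfK T.D T.K) (logvAnalytic_analyticLogv (F := T.K))).Adm
          (summandPiecesPr (pilotDataOfK T.D T.K) (logvAnalytic_analyticLogv (F := T.K))).logvol (Ψ P l T) (act P l T) (Mmod P l T)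
          (region P l T) (frobAdm P l T) (frobLogvol P l T) (fun k _ => Ψ P l T k) (frobMmod P l T) (unitImage P l T)
          (ballImage P l T) (thetaDiv P l T))
        (settingPrVolSharp (pilotDataOfK T.D T.K) (logvAnalytic_analyticLogv (F := T.K)) (M P l T) (archPk P l T) (archSub P l T) (Ψ P l T)
          (act P l T) (Mmod P l T) (region P l T) (n P l T) (lat P l T) (sig P l T) (split P l T) (qData P l T) (tq P l T)
          (t P l T) (htq0 P l T) (htq1 P l T)) (ρ P l T) (qK P l T))
    -- [PIN] the Corollary's own region pins (pΘ)(pq′), AT THESE DATA (`hBridge` is no longer a binder: p424856)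
    (hPin : ∀ (P : NFPoint) (l : ℕ) (T : Cor22.ThetaVolumeDatumAt P l), letI := T.instFieldF; letI := T.instNumberFieldF; letI := T.instAlgebraF; letI := T.instFieldK;
        letI := T.instNumberFieldK; letI := T.instAlgebraK; letI := T.instFieldFbar; letI := T.instAlgebraFbar;
        letI := T.instAlgebraKFbar; letI := T.instIsElliptic;
      Cor312Vol.PinnedRegions
        (LatticeSituation.ofShells (logShellsDH (pilotDataOfK T.D T.K) (analyticLogv T.K)) (M P l T) (archPk P l T)
          (archSub P l T) (summandPiecesPr (pilotDataOfK T.D T.K) (logvAnalytic_analyticLogv (F := T.K))).Adm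
          (summandPiecesPr (pilotDataOfK T.D T.K) (logvAnalytic_analyticLogv (F := T.K))).logvol (Ψ P l T) (act P l T) (Mmod P l T)
          (region P l T) (frobAdm P l T) (frobLogvol P l T) (fun k _ => Ψ P l T k) (frobMmod P l T) (unitImage P l T)
          (ballImage P l T) (thetaDiv P l T))
        (settingPrVolSharp (pilotDataOfK T.D T.K) (logvAnalytic_analyticLogv (F := T.K)) (M P l T) (archPk P l T) (archSub P l T) (Ψ P l T)
          (act P l T) (Mmod P l T) (region P l T) (n P l T) (lat P l T) (sig P l T) (split P l T) (qData P l T) (tq P l T)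
          (t P l T) (htq0 P l T) (htq1 P l T)) (ρ P l T) (qK P l T))
    -- [FACT] (none) · [CONE] (none: (ii)(b)@n is `rfl` in the strictified reading; NO (ii′) binder — the per-image estimate is a theorem)
    -- [READ] the per-image Θ-side reading: every global possible image of the genuine setting has procession-normalised log-volume
    --   ≤ the datum's −|log(Θ)|_(P) (`hq` is no longer a binder: c312-7 ∘ c312-8)
    (hΘP : ∀ (P : NFPoint) (l : ℕ) (T : Cor22.ThetaVolumeDatumAt P l), letI := T.instFieldF; letI := T.instNumberFieldF; letI := T.instAlgebraF; letI := T.instFieldK;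
        letI := T.instNumberFieldK; letI := T.instAlgebraK; letI := T.instFieldFbar; letI := T.instAlgebraFbar;
        letI := T.instAlgebraKFbar; letI := T.instIsElliptic;
      ∀ U : ImageChoice
        (settingPrVolSharp (pilotDataOfK T.D T.K) (logvAnalytic_analyticLogv (F := T.K)) (M P l T) (archPk P l T) (archSub P l T) (Ψ P l T)
          (act P l T) (Mmod P l T) (region P l T) (n P l T) (lat P l T) (sig P l T) (split P l T) (qData P l T) (tq P l T)
          (t P l T) (htq0 P l T) (htq1 P l T)),
        processionNormalized (fun i : Fin (thetaIndex (pilotDataOfK T.D T.K)).lstar =>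
          ∑ᶠ vQ : (thetaIndex (pilotDataOfK T.D T.K)).VQ,
            ((LatticeSituation.ofShells (logShellsDH (pilotDataOfK T.D T.K) (analyticLogv T.K)) (M P l T) (archPk P l T)
                (archSub P l T) (summandPiecesPr (pilotDataOfK T.D T.K) (logvAnalytic_analyticLogv (F := T.K))).Adm
                (summandPiecesPr (pilotDataOfK T.D T.K) (logvAnalytic_analyticLogv (F := T.K))).logvol (Ψ P l T) (act P l T) (Mmod P l T)
                (region P l T) (frobAdm P l T) (frobLogvol P l T) (fun k _ => Ψ P l T k) (frobMmod P l T) (unitImage P l T)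
                (ballImage P l T) (thetaDiv P l T)).D
              (settingPrVolSharp (pilotDataOfK T.D T.K) (logvAnalytic_analyticLogv (F := T.K)) (M P l T) (archPk P l T) (archSub P l T)
                (Ψ P l T) (act P l T) (Mmod P l T) (region P l T) (n P l T) (lat P l T) (sig P l T) (split P l T) (qData P l T)
                (tq P l T) (t P l T) (htq0 P l T) (htq1 P l T)).n).logvol (Setting.labelSucc i) vQ (U.1 (i, vQ))) ≤
          T.negLogThetaPerImage) :
    _root_.ABC :=
  -- [IUTchIII] Cor 3.12 READ PER IMAGE at EVERY genuine Θ-volume datum, AT ITS GENUINE REAL SETTING (§1 under `T`'s bundled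
  -- instances), then abc-iut-S2's hvol-free endpoint
  ABC_of_cor312PerImage fun P _ l _ _ _ _ _ _ T => by
    letI := T.instFieldF; letI := T.instNumberFieldF; letI := T.instAlgebraF; letI := T.instFieldK
    letI := T.instNumberFieldK; letI := T.instAlgebraK; letI := T.instFieldFbar; letI := T.instAlgebraFbar
    letI := T.instAlgebraKFbar; letI := T.instIsElliptic
    exact PerImageK.cor312PerImageOf_of_S_genuineK T.D T.K (M P l T) (archPk P l T) (archSub P l T) (Ψ P l T) (act P l T)
      (Mmod P l T) (region P l T) (frobAdm P l T) (frobLogvol P l T) (frobMmod P l T) (unitImage P l T) (ballImage P l T)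
      (thetaDiv P l T) (n P l T) (lat P l T) (sig P l T) (split P l T) (qData P l T) (t P l T) (tq P l T) (ρ P l T) (qK P l T)
      T.isVolumeInputOf (htq0 P l T) (htq1 P l T) (htq P l T) (hS P l T) (hPin P l T) (hΘP P l T)


/-! ## §3. Non-vacuity of the SIDE class at the apex (family level) -/

/-- **The family-level SIDE binders of `abc_of_S_perImage_genuineK` are jointly satisfiable**: there exist q-ideles `tq P l T` in the completions of
`T.K` at `pilotDataOfK T.D T.K`, for ALL data at once, meeting `htq0` ∧ `htq1` ∧ `htq` (binder types as in §2) — choice over abc-iut-C-cert-3's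
per-datum existence theorem `Cor312Prov.exists_realising_qIdeles_pilotDataOfK` (p434704; [IUTchI] Ex. 3.2 (iv) for the typed `K`,
`twoMulLDvdOrdq_pilotDataOfK`). So this certificate is NOT vacuous on its SIDE class (contrast p432966 / p435435); its content beyond inhabited
data is exactly `hS` + `hPin` + `hΘP`, about whose joint satisfiability nothing is claimed. No side taken; typed ≠ proved.
[cite: Mochizuki2012, IUTchI Ex. 3.2 (iv) p. 71] [cite: DupuyHilado2025, §3.4] -/
theorem perImage_genuineK_sideConditions_satisfiable :
    ∃ (tq : ∀ (P : NFPoint) (l : ℕ) (T : Cor22.ThetaVolumeDatumAt P l), letI := T.instFieldF; letI := T.instNumberFieldF; letI := T.instAlgebraF; letI := T.instFieldK;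
          letI := T.instNumberFieldK; letI := T.instAlgebraK; letI := T.instFieldFbar; letI := T.instAlgebraFbar;
          letI := T.instAlgebraKFbar; letI := T.instIsElliptic;
        ∀ (pp : Nat.Primes) (x : (thetaIndex (pilotDataOfK T.D T.K)).Fibre (.inr pp)), haveI : Fact (pp : ℕ).Prime := ⟨pp.2⟩; kOf (pilotDataOfK T.D T.K) pp.1 x),
      (∀ P l T pp x, tq P l T pp x ≠ 0) ∧
      (∀ (P : NFPoint) (l : ℕ) (T : Cor22.ThetaVolumeDatumAt P l), letI := T.instFieldF; letI := T.instNumberFieldF; letI := T.instAlgebraF; letI := T.instFieldK;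
          letI := T.instNumberFieldK; letI := T.instAlgebraK; letI := T.instFieldFbar; letI := T.instAlgebraFbar;
          letI := T.instAlgebraKFbar; letI := T.instIsElliptic;
        ∀ (pp : Nat.Primes) (x : (thetaIndex (pilotDataOfK T.D T.K)).Fibre (.inr pp)),
          haveI : Fact (pp : ℕ).Prime := ⟨pp.2⟩; placeOf (pilotDataOfK T.D T.K) pp.1 x ∉ (pilotDataOfK T.D T.K).S → ‖tq P l T pp x‖ = 1) ∧
      (∀ (P : NFPoint) (l : ℕ) (T : Cor22.ThetaVolumeDatumAt P l), letI := T.instFieldF; letI := T.instNumberFieldF; letI := T.instAlgebraF; letI := T.instFieldK;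
          letI := T.instNumberFieldK; letI := T.instAlgebraK; letI := T.instFieldFbar; letI := T.instAlgebraFbar;
          letI := T.instAlgebraKFbar; letI := T.instIsElliptic;
        ∀ (pp : Nat.Primes) (x : (thetaIndex (pilotDataOfK T.D T.K)).Fibre (.inr pp)),
          haveI : Fact (pp : ℕ).Prime := ⟨pp.2⟩
          Real.log ‖tq P l T pp x‖ = -((pilotDataOfK T.D T.K).qPilot (placeOf (pilotDataOfK T.D T.K) pp.1 x)) * logNorm T.K (placeOf (pilotDataOfK T.D T.K) pp.1 x) /
            localDegree T.K (placeOf (pilotDataOfK T.D T.K) pp.1 x)) := by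
  have hW : ∀ (P : NFPoint) (l : ℕ) (T : Cor22.ThetaVolumeDatumAt P l), letI := T.instFieldF; letI := T.instNumberFieldF; letI := T.instAlgebraF; letI := T.instFieldK;
      letI := T.instNumberFieldK; letI := T.instAlgebraK; letI := T.instFieldFbar; letI := T.instAlgebraFbar;
      letI := T.instAlgebraKFbar; letI := T.instIsElliptic;
      ∃ tq : ∀ (pp : Nat.Primes) (x : (thetaIndex (pilotDataOfK T.D T.K)).Fibre (.inr pp)),
          haveI : Fact (pp : ℕ).Prime := ⟨pp.2⟩; kOf (pilotDataOfK T.D T.K) pp.1 x,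
        (∀ pp x, tq pp x ≠ 0) ∧
        (∀ (pp : Nat.Primes) (x : (thetaIndex (pilotDataOfK T.D T.K)).Fibre (.inr pp)),
            haveI : Fact (pp : ℕ).Prime := ⟨pp.2⟩; placeOf (pilotDataOfK T.D T.K) pp.1 x ∉ (pilotDataOfK T.D T.K).S → ‖tq pp x‖ = 1) ∧
          ∀ (pp : Nat.Primes) (x : (thetaIndex (pilotDataOfK T.D T.K)).Fibre (.inr pp)),
            haveI : Fact (pp : ℕ).Prime := ⟨pp.2⟩
            Real.log ‖tq pp x‖ = -((pilotDataOfK T.D T.K).qPilot (placeOf (pilotDataOfK T.D T.K) pp.1 x)) *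
              logNorm T.K (placeOf (pilotDataOfK T.D T.K) pp.1 x) / localDegree T.K (placeOf (pilotDataOfK T.D T.K) pp.1 x) :=
    fun P l T => by
      letI := T.instFieldF; letI := T.instNumberFieldF; letI := T.instAlgebraF; letI := T.instFieldK
      letI := T.instNumberFieldK; letI := T.instAlgebraK; letI := T.instFieldFbar; letI := T.instAlgebraFbar
      letI := T.instAlgebraKFbar; letI := T.instIsElliptic
      exact Cor312Prov.exists_realising_qIdeles_pilotDataOfK T.D
  refine ⟨fun P l T => (hW P l T).choose, ?_, ?_, ?_⟩
  · exact fun P l T => (hW P l T).choose_spec.1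
  · exact fun P l T => (hW P l T).choose_spec.2.1
  · exact fun P l T => (hW P l T).choose_spec.2.2

end Family

end Summit.ABC.IUTFork.Conditional

end
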